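import Mathlib.Data.Matrix.Block
import Mathlib.LinearAlgebra.Matrix.NonsingularInverse
import Mathlib.LinearAlgebra.Matrix.ToLinearEquiv
import Mathlib.Tactic.FinCases
import Mathlib.Tactic.Abel
import HarnessLib

/-!
# The symplectic block dichotomy in matrices (stub `stub_symplecticBlockDichotomy`) — line `sector-klingen-split`,
# crux `ResiduallyYoshidaLifting` (stmt-Langlands-13639)

Stub-worker of lead prover-line-stmt-Langlands-13639-c4-0 (wave 1, 2026-08-17), skeleton rev 7, sub-goal T6 (the symplectic
plane dichotomy T12 of the disprover, IN MATRICES; used by the lead to exclude Siegel-type reducible symplectic realisers).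

Let `J = (J₁₁, X; -Xᵀ, Y)` be a Gram matrix in `2 × 2` blocks over a field `K` with `2 ≠ 0`, with `J₁₁ᵀ = -J₁₁` and `det J ≠ 0`,
and let `r g = (τ g, C g; 0, τ' g)` (`g : Γ`) be block upper-triangular similitudes of `J` (`(r g)ᵀ J (r g) = ν g • J`: the plane
spanned by the first two basis vectors is stable) with every `τ g` invertible.  Reading off the blocks `(1,1)` and `(1,2)` of the
similitude identity (`Matrix.fromBlocks_transpose/_multiply/_smul/_inj`) gives
`(τ g)ᵀ J₁₁ (τ g) = ν g • J₁₁` and `(τ g)ᵀ J₁₁ (C g) + (τ g)ᵀ X (τ' g) = ν g • X`.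
A `2 × 2` matrix with `Mᵀ = -M` has zero diagonal (this is where `2 ≠ 0` enters) and opposite off-diagonal entries, so EITHER
`J₁₁ = 0` — the stable plane is LAGRANGIAN: then `(τ g)ᵀ X (τ' g) = ν g • X`, and `X` is invertible because a row vector `(y, 0)`
with `y X = 0`, `y ≠ 0` would lie in the left kernel of `J = (0, X; -Xᵀ, Y)` — OR `det J₁₁ = (J₁₁ 0 1)² ≠ 0`, and then
`Z = -J₁₁⁻¹ X` satisfies `C g = Z τ' g - τ g Z` for every `g` (the unipotent `(1, Z; 0, 1)` block-diagonalises every `r g`):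
multiply the claimed identity on the left by the invertible `(τ g)ᵀ J₁₁` and use the two block identities.

Pure Mathlib matrix algebra; no named facts.  The hypotheses `Yᵀ = -Y` and `ν g ≠ 0` of the registered signature are not used
by the proof (they hold in the application and are kept because the signature is registered verbatim).
-/

noncomputable section

set_option linter.dupNamespace false
set_option autoImplicit false

open scoped Matrix

namespace Summit.Langlands.Langlands.Cruxes.ResiduallyYoshidaLifting.SectorKlingenSplit.Fibre

/-- Blocks `(1,1)` and `(1,2)` of the similitude identity `rᵀ J r = ν • J` for a block upper-triangular `r = (τ, C; 0, τ')`
and `J = (J₁₁, X; X', Y)` (square blocks of one size over a commutative ring):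
`τᵀ J₁₁ τ = ν • J₁₁` and `τᵀ J₁₁ C + τᵀ X τ' = ν • X`. [folklore] -/
theorem blocks_of_upper_similitude {K : Type*} [CommRing K] {m : Type*} [Fintype m]
    (τ C τ' J₁₁ X X' Y : Matrix m m K) (ν : K)
    (h : (Matrix.fromBlocks τ C 0 τ')ᵀ * Matrix.fromBlocks J₁₁ X X' Y * Matrix.fromBlocks τ C 0 τ' =
      ν • Matrix.fromBlocks J₁₁ X X' Y) :
    τᵀ * J₁₁ * τ = ν • J₁₁ ∧ τᵀ * J₁₁ * C + τᵀ * X * τ' = ν • X := by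
  rw [Matrix.fromBlocks_transpose, Matrix.fromBlocks_multiply, Matrix.fromBlocks_multiply,
    Matrix.fromBlocks_smul, Matrix.fromBlocks_inj] at h
  obtain ⟨h11, h12, -, -⟩ := h
  simp only [Matrix.transpose_zero, Matrix.zero_mul, Matrix.mul_zero, add_zero] at h11 h12
  exact ⟨h11, h12⟩

/-- In characteristic `≠ 2`, a `2 × 2` matrix with `Mᵀ = -M` has zero diagonal and opposite off-diagonal entries:
`M 0 0 = 0`, `M 1 1 = 0`, `M 1 0 = -M 0 1` (so `M = (M 0 1) • J₂`). [folklore] -/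
theorem entries_of_transpose_eq_neg {K : Type*} [Field K] (h2 : (2 : K) ≠ 0) {M : Matrix (Fin 2) (Fin 2) K}
    (hM : Mᵀ = -M) : M 0 0 = 0 ∧ M 1 1 = 0 ∧ M 1 0 = -M 0 1 := by
  have h : ∀ i j, M j i = -M i j := fun i j => by
    have e := congrFun (congrFun hM i) j
    rwa [Matrix.transpose_apply, Matrix.neg_apply] at e
  have hd : ∀ i, M i i = 0 := fun i => by
    have e : M i i + M i i = 0 := eq_neg_iff_add_eq_zero.mp (h i i)
    rwa [← two_mul, mul_eq_zero, or_iff_right h2] at e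
  exact ⟨hd 0, hd 1, h 0 1⟩

/-- If `J = (0, X; X', Y)` (square blocks of one size over a field) has `det J ≠ 0` then `X` is invertible: for a row vector
`y ≠ 0` with `y X = 0`, the row vector `(y, 0)` would lie in the left kernel of `J`. [folklore] -/
theorem isUnit_det_of_det_fromBlocks_zero₁₁_ne_zero {K : Type*} [Field K] {m : Type*} [Fintype m] [DecidableEq m]
    (X X' Y : Matrix m m K) (hdet : (Matrix.fromBlocks 0 X X' Y).det ≠ 0) : IsUnit X.det := by
  rw [isUnit_iff_ne_zero]
  intro hX
  obtain ⟨y, hy0, hyX⟩ := Matrix.exists_vecMul_eq_zero_iff.mpr hX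
  refine hdet (Matrix.exists_vecMul_eq_zero_iff.mp ⟨Sum.elim y 0, ?_, ?_⟩)
  · intro h
    apply hy0
    funext i
    simpa using congrFun h (Sum.inl i)
  · rw [Matrix.vecMul_fromBlocks, Sum.elim_comp_inl, Sum.elim_comp_inr, hyX, Matrix.vecMul_zero,
      Matrix.zero_vecMul, Matrix.zero_vecMul, add_zero, Sum.elim_zero_zero]

/-- **Registered sub-goal T6 `stub_symplecticBlockDichotomy`** (skeleton rev 7 of line `sector-klingen-split`): the symplectic
plane dichotomy IN MATRICES.  A block upper-triangular similitude `(τ, C; 0, τ')` of a non-degenerate alternating Gram matrix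
`(J₁₁, X; -Xᵀ, Y)` (`2 × 2` blocks over a field with `2 ≠ 0`, `τ` invertible) either has its plane LAGRANGIAN (`J₁₁ = 0`; then `X`
is invertible and `τᵀ X τ' = ν X` — Lagrangian duality `τ' = ν X⁻¹ τ⁻ᵀ X`) or is block-DIAGONALISED by the unipotent `(1, Z; 0, 1)`
with `Z = -J₁₁⁻¹ X` (`C = Z τ' - τ Z`, one `Z` for all `g`). [folklore] -/
theorem stub_symplecticBlockDichotomy :
    ∀ (K : Type) [Field K], (2 : K) ≠ 0 → ∀ (Γ : Type)
      (τ τ' C : Γ → Matrix (Fin 2) (Fin 2) K) (ν : Γ → K) (J₁₁ X Y : Matrix (Fin 2) (Fin 2) K),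
      J₁₁ᵀ = -J₁₁ → Yᵀ = -Y → (Matrix.fromBlocks J₁₁ X (-Xᵀ) Y).det ≠ 0 →
      (∀ g, IsUnit (τ g).det) → (∀ g, ν g ≠ 0) →
      (∀ g, (Matrix.fromBlocks (τ g) (C g) 0 (τ' g))ᵀ * Matrix.fromBlocks J₁₁ X (-Xᵀ) Y *
          Matrix.fromBlocks (τ g) (C g) 0 (τ' g) = ν g • Matrix.fromBlocks J₁₁ X (-Xᵀ) Y) →
      (J₁₁ = 0 ∧ IsUnit X.det ∧ ∀ g, (τ g)ᵀ * X * τ' g = ν g • X) ∨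
      (∃ Z : Matrix (Fin 2) (Fin 2) K, ∀ g, C g = Z * τ' g - τ g * Z) := by
  intro K _ h2 Γ τ τ' C ν J₁₁ X Y hJ _hY hdet hτ _hν hsim
  -- the two block identities `(1,1)` and `(1,2)` of `rᵀ J r = ν J`
  have hb := fun g => blocks_of_upper_similitude (τ g) (C g) (τ' g) J₁₁ X (-Xᵀ) Y (ν g) (hsim g)
  obtain ⟨hd0, hd1, hoff⟩ := entries_of_transpose_eq_neg h2 hJ
  by_cases ha : J₁₁ 0 1 = 0
  · -- `J₁₁ = 0`: the stable plane is Lagrangian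
    left
    have hJ0 : J₁₁ = 0 := by
      ext i j
      fin_cases i <;> fin_cases j <;> simp [hd0, hd1, hoff, ha]
    subst hJ0
    refine ⟨rfl, isUnit_det_of_det_fromBlocks_zero₁₁_ne_zero X (-Xᵀ) Y hdet, fun g => ?_⟩
    have e := (hb g).2
    rwa [Matrix.mul_zero, Matrix.zero_mul, zero_add] at e
  · -- `det J₁₁ = (J₁₁ 0 1)² ≠ 0`: block-diagonalise by the unipotent `(1, Z; 0, 1)`, `Z = -J₁₁⁻¹ X`
    right
    have hJdet : IsUnit J₁₁.det := by
      rw [isUnit_iff_ne_zero, Matrix.det_fin_two, hd0, hd1, hoff, zero_mul, zero_sub, mul_neg, neg_neg]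
      exact mul_ne_zero ha ha
    refine ⟨-(J₁₁⁻¹ * X), fun g => ?_⟩
    have hUdet : IsUnit ((τ g)ᵀ * J₁₁).det := by
      rw [Matrix.det_mul, Matrix.det_transpose]
      exact (hτ g).mul hJdet
    -- the claimed identity, multiplied on the left by the invertible `(τ g)ᵀ J₁₁`
    have key : (τ g)ᵀ * J₁₁ * C g = (τ g)ᵀ * J₁₁ * (-(J₁₁⁻¹ * X) * τ' g - τ g * -(J₁₁⁻¹ * X)) := by
      rw [eq_sub_of_add_eq (hb g).2]
      calc ν g • X - (τ g)ᵀ * X * τ' g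
          = (τ g)ᵀ * J₁₁ * τ g * (J₁₁⁻¹ * X) - (τ g)ᵀ * (J₁₁ * (J₁₁⁻¹ * (X * τ' g))) := by
            rw [(hb g).1, Matrix.smul_mul, Matrix.mul_nonsing_inv_cancel_left J₁₁ _ hJdet,
              Matrix.mul_nonsing_inv_cancel_left J₁₁ _ hJdet, Matrix.mul_assoc]
        _ = (τ g)ᵀ * J₁₁ * (-(J₁₁⁻¹ * X) * τ' g - τ g * -(J₁₁⁻¹ * X)) := by
            simp only [Matrix.mul_neg, Matrix.neg_mul, Matrix.mul_add, sub_neg_eq_add, Matrix.mul_assoc]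
            abel
    calc C g = ((τ g)ᵀ * J₁₁)⁻¹ * ((τ g)ᵀ * J₁₁ * C g) :=
        (Matrix.nonsing_inv_mul_cancel_left ((τ g)ᵀ * J₁₁) _ hUdet).symm
      _ = -(J₁₁⁻¹ * X) * τ' g - τ g * -(J₁₁⁻¹ * X) := by
          rw [key, Matrix.nonsing_inv_mul_cancel_left ((τ g)ᵀ * J₁₁) _ hUdet]

end Summit.Langlands.Langlands.Cruxes.ResiduallyYoshidaLifting.SectorKlingenSplit.Fibre

end
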